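import Mathlib
import HarnessLib
import Literature.RingTheory.MvPolynomial.VariableIdeals
import Summits.ResolutionOfSingularities.ResolutionOfSingularities.Theorems.WildQuotientsWildQuotientResolutionJordanFiveTwistedChartI12

/-!
# RUNG V5 (J₅), brick HP₁ ring side (1): the vertex locus of the twisted `μ₃` root chart,
# `√⟨ψ₅ x_a, ψ₅ x_b, ψ₅ x_c, ψ₅ x_d, q_j (j ≠ 1)⟩ = ⟨x_a, x_b, x_c, x_d⟩`
(crux stmt-ResolutionOfSingularities-15640 `WildQuotients.WildQuotientResolution`, line `Sketch`;
chain w45c RUNG V5 `JordanFive.jordanFive_hasResolution_of_bricks`, brick HP₁ RING SIDE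
(res-L1-w45c-plan-1 NAMED 2026-08-27T11:35:13Z: «stub-2 = `JordanFive.exists_ringBrick_X1_model` in
036's H₁ mould»); the exact J₅ twin of res-type-036's `JordanFour.radical_span_twistedVertex_eq`
(p508119) over res-L1-w45c-stub-1's twisted chart `JordanFive.twistedChart` (p521874) and cofactor
vector `JordanFive.twistedCofactor12` (…JordanFiveTwistedChartI12). [OURS · L1 W4.5c] — NOT a
statement of any manuscript; replaces the role of no printed item. Prover res-L1-w45c-stub-2.)

Slots `l = X b`, `A = X a`, `ξ = X c`, `η₁ = X d`. On the universal twisted chart at the `μ₃`-vertex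
the vertex curve `C_b` pulls back to `{l = A = ξ = η₁ = 0}`: the ideal generated by
`ψ₅(x_a) = l⁴A`, `ψ₅(x_b) = l³(1+Aξ)`, `ψ₅(x_c) = l²P`, `ψ₅(x_d) = lD/6` and the chart ratios
`q_j = ψ₅(g_j)/l¹²`, `j ≠ 1` (`g₁ = x_b⁴` is the vertex generator, `q₁ = (1+Aξ)⁴` the unit one) has
radical `⟨x_a, x_b, x_c, x_d⟩` (`radical_span_twistedVertexX1_eq`): `⊆` since every listed generator
lies in that prime (`twistedCofactor12_mem_span_X`: for `j ≠ 1` the cofactor has a factor `l`, `A`,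
`P` or `D/6`), `⊇` from `q₀ = A³`, `q₂ = P⁶`, `q₃ = (D/6)¹²` and `ψ₅(x_b) = l³(1 + Aξ)`.
-/

-- single-problem summit: the doubled namespace component `ResolutionOfSingularities` is forced
set_option linter.dupNamespace false

noncomputable section

open MvPolynomial

namespace Summit.ResolutionOfSingularities.ResolutionOfSingularities.Theorems.WildQuotientResolution.JordanFive

variable (k : Type) [Field k] (n : ℕ) (a b c d e : Fin n)

/-- A five-fold product lies in an ideal as soon as one of four named factors does. [folklore] -/
theorem prod5_mem {R : Type*} [CommRing R] {I : Ideal R} {x y u v z : R}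
    (h : x ∈ I ∨ y ∈ I ∨ v ∈ I ∨ z ∈ I) : x * y * u * v * z ∈ I := by
  rcases h with h | h | h | h
  · exact I.mul_mem_right _ (I.mul_mem_right _ (I.mul_mem_right _ (I.mul_mem_right _ h)))
  · exact I.mul_mem_right _ (I.mul_mem_right _ (I.mul_mem_right _ (I.mul_mem_left _ h)))
  · exact I.mul_mem_right _ (I.mul_mem_left _ h)
  · exact I.mul_mem_left _ h

/-- The variables `x_a, x_b, x_c, x_d` lie in `⟨x_a, x_b, x_c, x_d⟩`. [folklore] -/
theorem X_mem_span_X_abcd {i : Fin n} (hi : i ∈ ({a, b, c, d} : Set (Fin n))) :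
    (X i : MvPolynomial (Fin n) k) ∈ Ideal.span (X '' ({a, b, c, d} : Set (Fin n))) :=
  Ideal.subset_span ⟨i, hi, rfl⟩

/-- `P = ξ + l + (A/2)(ξ² − lξ − η₁) ∈ ⟨x_a, x_b, x_c, x_d⟩`. [folklore] -/
theorem twistedP_mem_span_X :
    JordanFour.twistedP k n a b c d ∈
      Ideal.span (X '' ({a, b, c, d} : Set (Fin n)) : Set (MvPolynomial (Fin n) k)) := by
  have ha := X_mem_span_X_abcd k n a b c d (i := a) (by simp)
  have hb := X_mem_span_X_abcd k n a b c d (i := b) (by simp)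
  have hc := X_mem_span_X_abcd k n a b c d (i := c) (by simp)
  rw [JordanFour.twistedP]
  refine Ideal.add_mem _ (Ideal.add_mem _ hc hb) ?_
  exact Ideal.mul_mem_right _ _ (Ideal.mul_mem_left _ _ ha)

/-- `D ∈ ⟨x_a, x_b, x_c, x_d⟩`. [folklore] -/
theorem twistedD_mem_span_X :
    twistedD k n a b c d ∈ Ideal.span (X '' ({a, b, c, d} : Set (Fin n)) : Set (MvPolynomial (Fin n) k)) := by
  have ha := X_mem_span_X_abcd k n a b c d (i := a) (by simp)
  have hb := X_mem_span_X_abcd k n a b c d (i := b) (by simp)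
  have hc := X_mem_span_X_abcd k n a b c d (i := c) (by simp)
  have hd := X_mem_span_X_abcd k n a b c d (i := d) (by simp)
  rw [twistedD]
  refine Ideal.add_mem _ (Ideal.add_mem _ (Ideal.sub_mem _ (Ideal.add_mem _ ?_ ?_) hd) ?_) ?_
  · exact Ideal.mul_mem_left _ _ (Ideal.pow_mem_of_mem _ hc 2 (by norm_num))
  · exact Ideal.mul_mem_left _ _ (Ideal.mul_mem_left _ _ hc)
  · exact Ideal.mul_mem_left _ _ (Ideal.pow_mem_of_mem _ hb 2 (by norm_num))
  · exact Ideal.mul_mem_left _ _ (by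
      refine Ideal.add_mem _ (Ideal.sub_mem _ (Ideal.sub_mem _ ?_ ?_) ?_) ?_
      · exact Ideal.pow_mem_of_mem _ hc 3 (by norm_num)
      · exact Ideal.mul_mem_left _ _ (Ideal.mul_mem_left _ _ (Ideal.pow_mem_of_mem _ hc 2 (by norm_num)))
      · exact Ideal.mul_mem_left _ _ (Ideal.mul_mem_right _ _ hc)
      · exact Ideal.mul_mem_left _ _ (Ideal.mul_mem_right _ _ (Ideal.pow_mem_of_mem _ hb 2 (by norm_num))))

/-- **Every chart ratio except the vertex one vanishes on the vertex curve**: for `j ≠ 1` the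
cofactor `q_j = l^{w−12} A^α (1+Aξ)^β P^γ (D/6)^δ` has a factor `l`, `A`, `P` or `D/6`, hence lies in
`⟨x_a, x_b, x_c, x_d⟩`. [OURS · L1 W4.5c] -/
theorem twistedCofactor12_mem_span_X (j : Fin 40) (hj : j ≠ 1) :
    twistedCofactor12 k n a b c d j ∈
      Ideal.span (X '' ({a, b, c, d} : Set (Fin n)) : Set (MvPolynomial (Fin n) k)) := by
  have ha := X_mem_span_X_abcd k n a b c d (i := a) (by simp)
  have hb := X_mem_span_X_abcd k n a b c d (i := b) (by simp)
  have hP := twistedP_mem_span_X k n a b c d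
  have hD : C (6⁻¹ : k) * twistedD k n a b c d ∈
      Ideal.span (X '' ({a, b, c, d} : Set (Fin n)) : Set (MvPolynomial (Fin n) k)) :=
    Ideal.mul_mem_left _ _ (twistedD_mem_span_X k n a b c d)
  have key : ∀ j : Fin 40, j ≠ 1 →
      0 < 4 * (exps12 j).1 + 3 * (exps12 j).2.1 + 2 * (exps12 j).2.2.1 + (exps12 j).2.2.2 - 12 ∨
        0 < (exps12 j).1 ∨ 0 < (exps12 j).2.2.1 ∨ 0 < (exps12 j).2.2.2 := by decide
  rw [twistedCofactor12]
  rcases key j hj with h | h | h | h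
  · exact prod5_mem (Or.inl (Ideal.pow_mem_of_mem _ hb _ h))
  · exact prod5_mem (Or.inr (Or.inl (Ideal.pow_mem_of_mem _ ha _ h)))
  · exact prod5_mem (Or.inr (Or.inr (Or.inl (Ideal.pow_mem_of_mem _ hP _ h))))
  · exact prod5_mem (Or.inr (Or.inr (Or.inr (Ideal.pow_mem_of_mem _ hD _ h))))

variable (hab : a ≠ b) (hac : a ≠ c) (had : a ≠ d) (hbc : b ≠ c) (hbd : b ≠ d) (hcd : c ≠ d)

include hab hac had hbc hbd hcd in
/-- The vertex-locus ideal of the twisted chart lies in `⟨x_a, x_b, x_c, x_d⟩`. [OURS · L1 W4.5c] -/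
theorem span_twistedVertexX1_le :
    Ideal.span (twistedChart k n a b c d e '' {X a, X b, X c, X d} ∪
        Set.range (fun j : {j : Fin 40 // j ≠ 1} => twistedCofactor12 k n a b c d j.1)) ≤
      Ideal.span (X '' ({a, b, c, d} : Set (Fin n)) : Set (MvPolynomial (Fin n) k)) := by
  have hb := X_mem_span_X_abcd k n a b c d (i := b) (by simp)
  rw [Ideal.span_le]
  rintro f (⟨x, hx, rfl⟩ | ⟨j, rfl⟩)
  · simp only [Set.mem_insert_iff, Set.mem_singleton_iff] at hx
    rcases hx with rfl | rfl | rfl | rfl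
    · rw [SetLike.mem_coe, twistedChart_X_a]
      exact Ideal.mul_mem_right _ _ (Ideal.pow_mem_of_mem _ hb 4 (by norm_num))
    · rw [SetLike.mem_coe, twistedChart_X_b k n a b c d e hab]
      exact Ideal.mul_mem_right _ _ (Ideal.pow_mem_of_mem _ hb 3 (by norm_num))
    · rw [SetLike.mem_coe, twistedChart_X_c k n a b c d e hac hbc]
      exact Ideal.mul_mem_right _ _ (Ideal.pow_mem_of_mem _ hb 2 (by norm_num))
    · rw [SetLike.mem_coe, twistedChart_X_d k n a b c d e had hbd hcd]
      exact Ideal.mul_mem_left _ _ (Ideal.mul_mem_right _ _ hb)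
  · exact twistedCofactor12_mem_span_X k n a b c d j.1 j.2

include hab hac had hbc hbd hcd in
/-- **The vertex locus of the twisted `μ₃` root chart: `√J_b = ⟨x_a, x_b, x_c, x_d⟩`.**
[OURS · L1 W4.5c] -/
theorem radical_span_twistedVertexX1_eq (h2 : (2 : k) ≠ 0) (h3 : (3 : k) ≠ 0) :
    (Ideal.span (twistedChart k n a b c d e '' {X a, X b, X c, X d} ∪
        Set.range (fun j : {j : Fin 40 // j ≠ 1} => twistedCofactor12 k n a b c d j.1))).radical =
      Ideal.span (X '' ({a, b, c, d} : Set (Fin n)) : Set (MvPolynomial (Fin n) k)) := by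
  haveI hprime := Literature.RingTheory.MvPolynomial.isPrime_span_X_image (R := k)
    ({a, b, c, d} : Set (Fin n))
  set J := Ideal.span (twistedChart k n a b c d e '' {X a, X b, X c, X d} ∪
        Set.range (fun j : {j : Fin 40 // j ≠ 1} => twistedCofactor12 k n a b c d j.1)) with hJ
  refine le_antisymm (hprime.radical_le_iff.mpr (span_twistedVertexX1_le k n a b c d e hab hac had
    hbc hbd hcd)) ?_
  -- generators of `J`
  have hgen : ∀ j : {j : Fin 40 // j ≠ 1}, twistedCofactor12 k n a b c d j.1 ∈ J := fun j =>
    Ideal.subset_span (Or.inr ⟨j, rfl⟩)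
  have hψ : ∀ x ∈ ({X a, X b, X c, X d} : Set (MvPolynomial (Fin n) k)),
      twistedChart k n a b c d e x ∈ J := fun x hx => Ideal.subset_span (Or.inl ⟨x, hx, rfl⟩)
  have h0 : (0 : Fin 40) ≠ 1 := by decide
  have h2' : (2 : Fin 40) ≠ 1 := by decide
  have h3' : (3 : Fin 40) ≠ 1 := by decide
  -- `x_a`
  have hXa : (X a : MvPolynomial (Fin n) k) ∈ J.radical := by
    refine ⟨3, ?_⟩
    have := hgen ⟨0, h0⟩
    simpa [twistedCofactor12, exps12] using this
  -- `x_b`: `l³(1 + Aξ) ∈ J` and `A ∈ √J`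
  have hXb : (X b : MvPolynomial (Fin n) k) ∈ J.radical := by
    refine Ideal.mem_radical_of_pow_mem (m := 3) ?_
    have h1 : (X b : MvPolynomial (Fin n) k) ^ 3 * (1 + X a * X c) ∈ J.radical := by
      have := hψ (X b) (by simp)
      rw [twistedChart_X_b k n a b c d e hab] at this
      exact Ideal.le_radical this
    have e1 : (X b : MvPolynomial (Fin n) k) ^ 3 =
        X b ^ 3 * (1 + X a * X c) - X b ^ 3 * X c * X a := by ring
    rw [e1]
    exact Ideal.sub_mem _ h1 (Ideal.mul_mem_left _ _ hXa)
  -- `x_c`: `P⁶ = q₂ ∈ J`, `P = ξ + l + (A/2)(…)`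
  have hP : JordanFour.twistedP k n a b c d ∈ J.radical := by
    refine ⟨6, ?_⟩
    have := hgen ⟨2, h2'⟩
    simpa [twistedCofactor12, exps12] using this
  have hXc : (X c : MvPolynomial (Fin n) k) ∈ J.radical := by
    have e1 : (X c : MvPolynomial (Fin n) k) = JordanFour.twistedP k n a b c d - X b -
        C (2⁻¹ : k) * X a * (X c ^ 2 - X b * X c - X d) := by
      rw [JordanFour.twistedP]; ring
    rw [e1]
    refine Ideal.sub_mem _ (Ideal.sub_mem _ hP hXb) ?_
    exact Ideal.mul_mem_right _ _ (Ideal.mul_mem_left _ _ hXa)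
  -- `x_d`: `(D/6)¹² = q₃ ∈ J`, `D = 3ξ² + 3lξ − η₁ + 2l² + A(…)`
  have h6 : (6 : k) ≠ 0 := by
    have := mul_ne_zero h2 h3; norm_num at this; exact this
  have hD : twistedD k n a b c d ∈ J.radical := by
    have hD' : C (6⁻¹ : k) * twistedD k n a b c d ∈ J.radical := by
      refine ⟨12, ?_⟩
      have := hgen ⟨3, h3'⟩
      simpa [twistedCofactor12, exps12] using this
    have e1 : twistedD k n a b c d = C (6 : k) * (C (6⁻¹ : k) * twistedD k n a b c d) := by
      rw [← mul_assoc, ← C_mul, mul_inv_cancel₀ h6, C_1, one_mul]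
    rw [e1]
    exact Ideal.mul_mem_left _ _ hD'
  have hXd : (X d : MvPolynomial (Fin n) k) ∈ J.radical := by
    have e1 : (X d : MvPolynomial (Fin n) k) = 3 * X c ^ 2 + 3 * (X b * X c) + 2 * X b ^ 2 +
        X a * (X c ^ 3 - 3 * (X b * X c ^ 2) - 3 * (X c * X d) + 2 * (X b ^ 2 * X c)) -
        twistedD k n a b c d := by
      rw [twistedD]; ring
    rw [e1]
    refine Ideal.sub_mem _ ?_ hD
    refine Ideal.add_mem _ (Ideal.add_mem _ (Ideal.add_mem _ ?_ ?_) ?_) ?_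
    · exact Ideal.mul_mem_left _ _ (Ideal.pow_mem_of_mem _ hXc 2 (by norm_num))
    · exact Ideal.mul_mem_left _ _ (Ideal.mul_mem_left _ _ hXc)
    · exact Ideal.mul_mem_left _ _ (Ideal.pow_mem_of_mem _ hXb 2 (by norm_num))
    · exact Ideal.mul_mem_right _ _ hXa
  -- conclusion
  rw [Ideal.span_le]
  rintro _ ⟨i, hi, rfl⟩
  simp only [Set.mem_insert_iff, Set.mem_singleton_iff] at hi
  rcases hi with rfl | rfl | rfl | rfl
  exacts [hXa, hXb, hXc, hXd]

end Summit.ResolutionOfSingularities.ResolutionOfSingularities.Theorems.WildQuotientResolution.JordanFive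

end
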